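import Literature.Probability.Percolation.BoxCrossingStacking
import HarnessLib

/-!
# Box crossings of isoradial square lattices: Corollary 6.2 in index coordinates

Grimmett–Manolescu, *Bond percolation on isoradial graphs* (PTRF 159 (2014) 273–327 =
arXiv:1204.0505), §6.2, proof of Corollary 6.2: "The homogeneous square lattice `G_{0,π/2}`
satisfies the BXP … By Proposition 6.1, `G_{0,β}` has BXP(δ₁) … `G_{α,β₀·1}` has the box-crossing
property … By Proposition 6.1 again, `G_{α,β}` has BXP(δ₃)." This file runs that iteration in
the vocabulary of `BoxCrossingIteration`, with the two transports as hypotheses (in the exact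
form proved in `HorizontalTransportHonest` / `VerticalTransportHonest`):

* `cor62_bounds` — for `0 < ε ≤ π/2`, uniform lower bounds for left–right crossings of `ρn × n`
  and top–bottom crossings of `n × ρn` index boxes, every `ρ ≥ 1`, over the whole class
  `AnglesIn ε` (base case `DiagonalBoxCrossing`; `G_{c,c+π/2} → G_{c,β}` by the two halves of
  Prop. 6.1; transposition; `G_{α,ξ} → G_{α,β}` by the horizontal half and transposition
  symmetry of the full class);
* `cor62_explicit` — the same, unpacked.

## References

* G. R. Grimmett, I. Manolescu, PTRF 159 (2014), arXiv:1204.0505, §6.1–§6.2 (Prop. 6.1, Cor. 6.2).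
-/

noncomputable section

namespace Literature.Probability.Percolation

open LatticeModels StarTriangle Real MeasureTheory Complex

namespace TrackExchange

/-! ### Small reductions -/

/-- Vertical crossings of `n × 2n` boxes give vertical crossings of squares. [folklore] -/
theorem tbLower_one_of_two {C : Set ((ℤ → ℝ) × (ℤ → ℝ))} (h : (tbLower C 2).Nonempty) : (tbLower C 1).Nonempty := by
  obtain ⟨⟨c, n₀⟩, hc, hb⟩ := h
  refine ⟨(c, n₀), hc, fun p hp n hn A B => (hb p hp n hn A B).trans ?_⟩
  exact measureReal_le_of_subset_ae p.1 p.2 fun ω hω h' => tbEvt_anti_height (le_refl B) (by push_cast; omega) hω h'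

/-- All aspect ratios, vertically, from aspect ratio two (chaining in the transposed class). [cite: GrimmettManolescu2014Isoradial, §2.3] -/
theorem tbLower_all_of_two {C : Set ((ℤ → ℝ) × (ℤ → ℝ))} (hH : (lrLower C 2).Nonempty) (hV : (tbLower C 2).Nonempty)
    {ρ : ℕ} (hρ : 1 ≤ ρ) : (tbLower C ρ).Nonempty := by
  have h1 : (lrLower (transpC C) 2).Nonempty := by
    obtain ⟨q, hq⟩ := hV
    exact ⟨q, lrLower_of_tbLower_transp (by rwa [transpC_transpC])⟩
  have h2 : (tbLower (transpC C) 2).Nonempty := by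
    obtain ⟨q, hq⟩ := hH
    exact ⟨q, tbLower_of_lrLower_transp (by rwa [transpC_transpC])⟩
  obtain ⟨q, hq⟩ := lrLower_all_of_two h1 h2 hρ
  exact ⟨q, tbLower_of_lrLower_transp hq⟩

/-! ### The classes of the iteration -/

/-- `{(c·1, β)}` with bounded angles: one constant sequence. [cite: GrimmettManolescu2014Isoradial, §6.2 (G_{0,β})] -/
def constC (ε : ℝ) : Set ((ℤ → ℝ) × (ℤ → ℝ)) := {p | (∃ c : ℝ, p.1 = fun _ => c) ∧ AnglesIn ε p.1 p.2}

/-- The full class `{(α, β)}` with bounded angles. [cite: GrimmettManolescu2014Isoradial, §6.2 (Cor. 6.2)] -/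
def anglesC (ε : ℝ) : Set ((ℤ → ℝ) × (ℤ → ℝ)) := {p | AnglesIn ε p.1 p.2}

/-- `constC ε` is shift invariant. [folklore] -/
theorem shift_constC (ε : ℝ) : ∀ p ∈ constC ε, ∀ s t : ℤ, ((fun i => p.1 (i - s)), (fun j => p.2 (j - t))) ∈ constC ε := by
  rintro p ⟨⟨c, hc⟩, ha⟩ s t
  exact ⟨⟨c, by funext i; rw [hc]⟩, ha.shift s t⟩

/-- `anglesC ε` is shift invariant. [folklore] -/
theorem shift_anglesC (ε : ℝ) : ∀ p ∈ anglesC ε, ∀ s t : ℤ, ((fun i => p.1 (i - s)), (fun j => p.2 (j - t))) ∈ anglesC ε :=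
  fun _ ha s t => AnglesIn.shift ha s t

/-- `anglesC ε` is its own transpose. [folklore] -/
theorem transpC_anglesC (ε : ℝ) : transpC (anglesC ε) = anglesC ε := by
  ext p
  simp only [transpC, anglesC, Set.mem_setOf_eq, AnglesIn]
  constructor
  · intro h i j; have := h j i; simp only [Set.mem_Icc] at this ⊢; constructor <;> linarith [this.1, this.2]
  · intro h i j; have := h j i; simp only [Set.mem_Icc] at this ⊢; constructor <;> linarith [this.1, this.2]

/-! ### Corollary 6.2 -/

/-- **Corollary 6.2 (index coordinates, lower bounds), from the two transports.** For
`ε ≤ π/2`, given the conclusions of Prop. 6.4 and Prop. 6.8 (constant `θ ∈ (0,1]`), the class of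
all `G_{α,β}` with `β_j - α_i ∈ [ε, π - ε]` has uniform lower bounds for left–right crossings of
`ρn × n` boxes and top–bottom crossings of `n × ρn` boxes, for every `ρ ≥ 1`.
[cite: GrimmettManolescu2014Isoradial, §6.2 Cor. 6.2 (proof)] -/
theorem cor62_bounds {ε θ : ℝ} (hε' : ε ≤ π / 2) (hθ : 0 < θ) (hθ1 : θ ≤ 1)
    (hHT : ∃ lam N₀ : ℕ, 1 ≤ lam ∧ 1 ≤ N₀ ∧ ∀ (ρ N : ℕ), 1 ≤ ρ → N₀ ≤ N → ∀ (α β : ℤ → ℝ) (ξ : ℝ),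
      AnglesIn ε α (fun _ => ξ) → AnglesIn ε α β →
      (1 - ρ * Real.exp (-N)) * (prodBernoulli (Percolation.gmWeight α fun _ => ξ)).real (initEventGM ρ N) ≤
        (prodBernoulli (Percolation.gmWeight α β)).real (finalEventGM ρ N (lam * N)))
    (hVT : ∀ N : ℕ, 1 ≤ N → ∀ u : ℕ, (u : ℝ) ≤ θ * N / 2 → ∀ (α β : ℤ → ℝ) (ξ : ℝ),
      AnglesIn ε α (fun _ => ξ) → AnglesIn ε α β →
      θ / 2 * (prodBernoulli (Percolation.gmWeight α fun _ => ξ)).real (cvInitGM N) ≤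
        (prodBernoulli (Percolation.gmWeight α β)).real (cvFinalGM N u))
    {ρ : ℕ} (hρ : 1 ≤ ρ) : (lrLower (anglesC ε) ρ).Nonempty ∧ (tbLower (anglesC ε) ρ).Nonempty := by
  have hπ := Real.pi_pos
  -- the base class
  have hH0 : ∀ ρ, 1 ≤ ρ → (lrLower baseC ρ).Nonempty := fun ρ hρ => lrLower_all_of_two base_lrLower base_tbLower hρ
  have hV0 : (tbLower baseC 1).Nonempty := tbLower_one_of_two base_tbLower
  -- one constant sequence
  have hsrc1 : ∀ p ∈ constC ε, ∃ ξ : ℝ, (p.1, fun _ => ξ) ∈ baseC ∧ AnglesIn ε p.1 (fun _ => ξ) ∧ AnglesIn ε p.1 p.2 := by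
    rintro p ⟨⟨c, hc⟩, ha⟩
    refine ⟨c + π / 2, ⟨c, by rw [hc]⟩, fun i j => ?_, ha⟩
    rw [hc]; simp only [Set.mem_Icc]; constructor <;> linarith
  have hH1 : ∀ ρ, 1 ≤ ρ → (lrLower (constC ε) ρ).Nonempty := fun ρ hρ =>
    lrLower_of_hTransport hHT hsrc1 (shift_constC ε) hH0 hV0 hρ
  have hV1 : (tbLower (constC ε) 2).Nonempty := tbLower_of_vTransport hθ hθ1 hVT hsrc1 (shift_constC ε) hV0 hH1
  have hV1' : ∀ ρ, 1 ≤ ρ → (tbLower (constC ε) ρ).Nonempty := fun ρ hρ => tbLower_all_of_two (hH1 2 (by norm_num)) hV1 hρ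
  -- its transpose: one constant sequence, the other one
  have hH2 : ∀ ρ, 1 ≤ ρ → (lrLower (transpC (constC ε)) ρ).Nonempty := fun ρ hρ => by
    obtain ⟨q, hq⟩ := hV1' ρ hρ
    exact ⟨q, lrLower_of_tbLower_transp (by rwa [transpC_transpC])⟩
  have hV2 : (tbLower (transpC (constC ε)) 1).Nonempty := by
    obtain ⟨q, hq⟩ := hH1 1 le_rfl
    exact ⟨q, tbLower_of_lrLower_transp (by rwa [transpC_transpC])⟩
  -- the full class
  have hsrc3 : ∀ p ∈ anglesC ε, ∃ ξ : ℝ, (p.1, fun _ => ξ) ∈ transpC (constC ε) ∧ AnglesIn ε p.1 (fun _ => ξ) ∧ AnglesIn ε p.1 p.2 := by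
    intro p ha
    have ha' : AnglesIn ε p.1 p.2 := ha
    refine ⟨p.2 0, ?_, fun i _ => ha' i 0, ha'⟩
    simp only [transpC, constC, Set.mem_setOf_eq]
    exact ⟨⟨-p.2 0, rfl⟩, fun i j => by have := ha' j 0; simp only [Set.mem_Icc] at this ⊢; constructor <;> linarith⟩
  have hH3 : ∀ ρ, 1 ≤ ρ → (lrLower (anglesC ε) ρ).Nonempty := fun ρ hρ =>
    lrLower_of_hTransport hHT hsrc3 (shift_anglesC ε) hH2 hV2 hρ
  refine ⟨hH3 ρ hρ, ?_⟩
  obtain ⟨q, hq⟩ := hH3 ρ hρ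
  exact ⟨q, tbLower_of_lrLower_transp (by rwa [transpC_anglesC])⟩

/-- **Corollary 6.2 (index coordinates), unpacked.** [cite: GrimmettManolescu2014Isoradial, §6.2 Cor. 6.2] -/
theorem cor62_explicit {ε θ : ℝ} (hε' : ε ≤ π / 2) (hθ : 0 < θ) (hθ1 : θ ≤ 1)
    (hHT : ∃ lam N₀ : ℕ, 1 ≤ lam ∧ 1 ≤ N₀ ∧ ∀ (ρ N : ℕ), 1 ≤ ρ → N₀ ≤ N → ∀ (α β : ℤ → ℝ) (ξ : ℝ),
      AnglesIn ε α (fun _ => ξ) → AnglesIn ε α β →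
      (1 - ρ * Real.exp (-N)) * (prodBernoulli (Percolation.gmWeight α fun _ => ξ)).real (initEventGM ρ N) ≤
        (prodBernoulli (Percolation.gmWeight α β)).real (finalEventGM ρ N (lam * N)))
    (hVT : ∀ N : ℕ, 1 ≤ N → ∀ u : ℕ, (u : ℝ) ≤ θ * N / 2 → ∀ (α β : ℤ → ℝ) (ξ : ℝ),
      AnglesIn ε α (fun _ => ξ) → AnglesIn ε α β →
      θ / 2 * (prodBernoulli (Percolation.gmWeight α fun _ => ξ)).real (cvInitGM N) ≤
        (prodBernoulli (Percolation.gmWeight α β)).real (cvFinalGM N u))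
    {ρ : ℕ} (hρ : 1 ≤ ρ) :
    ∃ c > (0 : ℝ), ∃ n₀ : ℕ, ∀ (α β : ℤ → ℝ), AnglesIn ε α β → ∀ n : ℕ, n₀ ≤ n → ∀ A B : ℤ,
      c ≤ (prodBernoulli (Percolation.gmWeight α β)).real (embRectCrossing (fun v => zDia v - ((A : ℂ) + (B : ℂ) * I)) (ρ * n : ℕ) n) ∧
      c ≤ (prodBernoulli (Percolation.gmWeight α β)).real (embTBCrossing (fun v => zDia v - ((A : ℂ) + (B : ℂ) * I)) n (ρ * n : ℕ)) := by
  obtain ⟨⟨⟨cH, nH⟩, hcH, hH⟩, ⟨⟨cV, nV⟩, hcV, hV⟩⟩ := cor62_bounds hε' hθ hθ1 hHT hVT hρ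
  refine ⟨min cH cV, lt_min hcH hcV, max nH nV, fun α β ha n hn A B => ⟨?_, ?_⟩⟩
  · exact (min_le_left _ _).trans (hH (α, β) ha n (le_trans (le_max_left _ _) hn) A B)
  · exact (min_le_right _ _).trans (hV (α, β) ha n (le_trans (le_max_right _ _) hn) A B)

end TrackExchange

end Literature.Probability.Percolation
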